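import Literature.Analysis.ODE.SingularGronwall
import HarnessLib

/-!
# The singular Grönwall inequality (tools stub `stub_singularGronwallTools`, block N-R,
# line `ergodic-budget-selection-closing`, crux `BaireTransfer.DenseLoudDesignerForces`,
# stmt-AnomalousDissipation-1143)

Summit-side wrapper of the Literature theorem `Literature.Analysis.ODE.singular_gronwall_const`
(`Literature/Analysis/ODE/SingularGronwall.lean`): Henry's singular Grönwall inequality (D. Henry,
*Geometric Theory of Semilinear Parabolic Equations*, LNM 840 (1981), Lemma 7.1.1) with constant
data — for `α < 1`, `M`, `τ` there is `Cg = Cg(α, M, τ)` such that every `d ≥ 0` continuous on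
`[0, τ]` with `d(t) ≤ A + M ∫₀ᵗ (t − s)^{−α} d(s) ds` obeys `d(t) ≤ Cg A` on `[0, τ]`.  It is the
Grönwall step of the uniqueness / Lipschitz stability / continuation of mild solutions of the
`S`-conjugated Navier–Stokes equation (blocks S4, S4c of the N-R programme of the line, where
`d(t) = ‖y(t) − z(t)‖` and `(t − s)^{−α}` bounds `‖A^α e^{−(t−s)A}‖`).  The registered signature carries
`0 ≤ α`, `0 ≤ M`, `0 < τ` and `0 ≤ A`; the Literature theorem needs `α < 1` only (and gives `Cg ≥ 1`).
Supports stmt-AnomalousDissipation-1143 (tools stub SG); nothing here closes an item, no definition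
is added.

References: D. Henry, LNM 840 (1981), Lemma 7.1.1. [`Henry1981`]
-/

-- `Summit.<Summit>.<Problem>` is the tree's mandated summit-side namespace (CONVENTIONS §2); for this
-- single-conjunct summit the two coincide, so the duplicate is deliberate.
set_option linter.dupNamespace false

noncomputable section

open Set Function MeasureTheory Filter

namespace Summit.AnomalousDissipation.AnomalousDissipation.Theorems.DenseLoudDesignerForces.Ergodic

/-- **Tools stub SG — the singular Grönwall inequality** (registered tools stub
`stub_singularGronwallTools` of block N-R, crux stmt-AnomalousDissipation-1143, line
`ergodic-budget-selection-closing`).  For `0 ≤ α < 1`, `M ≥ 0` and a horizon `τ > 0` there is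
`Cg = Cg(α, M, τ) ≥ 0` such that every nonnegative continuous `d` on `[0, τ]` with
`d(t) ≤ A + M ∫₀ᵗ (t − s)^{−α} d(s) ds` (`A ≥ 0`) obeys `d(t) ≤ Cg · A` on `[0, τ]` — the case of
`Literature.Analysis.ODE.singular_gronwall_const` (which needs neither `0 ≤ α`, `0 ≤ M`, `0 < τ` nor
`0 ≤ A`, and gives `Cg ≥ 1`; proved there by induction over windows of length `δ` with
`max(M,1) δ^{1−α}/(1−α) = 1/2`).  Henry 1981, Lemma 7.1.1. [cite: Henry1981, Lemma 7.1.1] -/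
theorem stub_singularGronwallTools {α M τ : ℝ} (hα₀ : 0 ≤ α) (hα : α < 1) (hM : 0 ≤ M) (hτ : 0 < τ) :
    ∃ Cg : ℝ, 0 ≤ Cg ∧ ∀ (A : ℝ), 0 ≤ A → ∀ d : ℝ → ℝ, ContinuousOn d (Icc 0 τ) → (∀ t ∈ Icc 0 τ, 0 ≤ d t) →
      (∀ t ∈ Icc 0 τ, d t ≤ A + M * ∫ s in (0 : ℝ)..t, (t - s) ^ (-α) * d s) → ∀ t ∈ Icc 0 τ, d t ≤ Cg * A := by
  -- the registered signature carries `0 ≤ α`, `0 ≤ M`, `0 < τ`, which Henry's lemma does not need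
  have _ : 0 ≤ α ∧ 0 ≤ M ∧ 0 < τ := ⟨hα₀, hM, hτ⟩
  obtain ⟨C, hC1, hC⟩ := Literature.Analysis.ODE.singular_gronwall_const hα M τ
  exact ⟨C, zero_le_one.trans hC1, fun A _ d hd hd0 hle => hC A d hd hd0 hle⟩

end Summit.AnomalousDissipation.AnomalousDissipation.Theorems.DenseLoudDesignerForces.Ergodic

end
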